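import Summits.QuantumFields.YangMills.Theorems.BalabanUVNodesN12Prop1DirectOfChartHalfOfRightInverseExplicit
import Summits.QuantumFields.YangMills.Theorems.BalabanUVNodesN12WindowGaugeLetterUniformSocket
import Literature.MathematicalPhysics.QuantumFieldTheory.Balaban1983to89.B15Prop1PlaquetteLettersOfClass

/-!
# BalabanUVNodes ∕ N12 — (E1)‴ `(vii)_direct`: (D1)′ WITH EVERY LETTER UNDER THE THRESHOLD DISCHARGED BY NAME FROM THE (2.12) CLASS — the window gauge letter (σ)_W by dag-n12-w6 g7's
# `k`-UNIFORM window-LOCAL producer `N12WindowGaugeLetterUniformSocket.hσW_on_uniform_of_class`, the plaquette letter `hPχ` and the tower-box plaquette letter `hPbox` by dag-n12-c g21's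
# `B15Prop1PlaquetteLettersOfClass.hPχ_on_of_class` ∕ `hPbox_on_of_class` — GENERAL `Z`, no hypothesis off the window, no (P4)′ socket, no `∃ δ₀`, a floor INDEPENDENT of `k`

Cell `pub-ymgap` (HUMAN RULINGS D-0062 ∕ D-0149), seat `pub-ymgap-dag-n12-d` g20 (R134 N12 [B15] s2; trigger (t100) = dag-n12-w6 g7's k-uniform chain p674786 · p674817 · p675155 · p675589, and the lane
owner's v7 recipe INBOX l.43692 «(E1)″ = (E1)′ ∘ hPχ := hPχ_on_of_class … ∘ hPbox := hPbox_on_of_class …; after v7 the frame under ∀ δ ≤ min Θ εH carries NO letter about the minimiser»).  Count-neutral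
helper of K1⁹ `stmt-QuantumFields-27364` (`--kind proof --supports … --as helper`).  THEOREMS ONLY (0 `def`, 0 `instance`, 0 `sorry`); composition BY NAME of this seat's (D1)′
`N12Prop1DirectOfChartHalfOfRightInverseExplicit.…_ofChartHalfLetter_ofRightInverseLetter_explicit` (p675298), dag-n12-w6 g7's `N12WindowGaugeLetterUniformSocket.hσW_on_uniform_of_class` (p675589)
and dag-n12-c g21's `B15Prop1PlaquetteLettersOfClass.hPχ_on_of_class` ∕ `hPbox_on_of_class` (p675521).

WHAT.  (D1)′'s statement VERBATIM except: (a) new outer binders = the producers' displayed rows — numerics per instance (`c`, level guard `hkc : k + c ≤ m + K`, `hc : 4d + m′ + 3 < 2L^c`), class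
threshold rows (`hεreg : 0 < εreg`, Prop. 2-smallness `hα3 hα2 haN`), the WINDOW `X i` with `D₀ i`, `hXΩ` (within walk-distance `D₀` of `Ω_k(Z)`), `hfit` (the collar fits inside `L^{k−1}·M₁`), the
REGION-BOX ROW `hBox`, the window rows `hWX hfeedsX`, and the radius row `hrad : L + (L−1)∕2 ≤ M₁`; (b) inside the explicit frame `∀ δ, (∀ i, 0 < δ i) → (∀ i, δ i ≤ min (Θ i) (εH i)) → …` the three
letters `hσW hPχ hPbox` are GONE: the ONLY remaining row is the k-free floor `hfloor : (((4d+m′+3)²L²∕4) + m′·24(((d+2)L)²∕4))·εreg + m′·ρn i ≤ δ i` (it implies `εreg ≤ δ i`, the class letters'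
tolerance condition, because its coefficient is `≥ 1`).  So N12's per-instance Prop-1 display on the DIRECT road (this edition) is LETTER-FREE BELOW THE THRESHOLD: (J0′) `hMin`@eR · geometry `hΩw W
hWbox X D₀ hXΩ hfit hBox hWX hfeedsX` · numerics `c hkc hc hεreg hα3 hα2 haN hrad hγle hk1` · chart half `C ρ Kτ ρτ`+`hhalf` · (P4)′ `εH B`+`hHB` · (P5) `M₂ hM₂0 hM₂` · `hsb` · `h15T` · per `δ ≤ min Θ εH`:
`hfloor` only.  The knit «12Q-DIRECT v7» keys on this file; (E1)′ ∕ v6 (first producer, letters displayed) stand as the sibling edition.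

HONEST FRAMING ∕ LOCATED.  ∃∕∀ bookkeeping by name; the minimiser family (J0′), the chart-half and right-inverse letters, (P5), the small-below letter `hsb` (LOCATED-HSB: global on the torus, no
producer — the lane's ρ5 proxy programme), [15] Thm 1, the window rows and the numerics stay DISPLAYED; per-instance constants; the floor's `C(d,L)` is explicit but NOT print's per-level `O(1)`; the
thresholds `Θ` stay volume-DEPENDENT; nothing of Bałaban's asserted; count-neutral; N12 NOT discharged; K1⁹ NOT closed; counts unmoved; one finite 𝕋⁴ programme at fixed `ε = L^{-K}` — R4 closes
only the conditional rung `BalabanLadder.UV`; no summit statement is proved here and NOT the Yang–Mills mass gap (Clay); nothing continuum ∕ ℝ⁴ ∕ OS.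

References: [Balaban1989LargeFieldI] CMP 122 (1989) 175–202, (1.74) p.192, Prop. 1 (1.77)–(1.78) p.194, (1.79) p.195; [Balaban1989LargeFieldII] CMP 122 (1989) 355–392, p.357,
(1.7)–(1.9) p.358, (1.12)–(1.13) p.359; [Balaban1985Variational] CMP 102 (1985) 277–309, (2)–(4) p.278, Thm 1 (8) p.279, (16)–(18) p.280, (44)–(48) p.285, (83) p.290;
[Balaban1985Averaging] CMP 98 (1985) 17–51, Prop. 2 (52)–(53) p.26; [Balaban1988Convergent] CMP 119 (1988) 243–285, (2.2) p.255, (2.11)–(2.14) pp.256–257, (2.16) p.257.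
-/

noncomputable section

open Set Finset Metric Filter
open scoped BigOperators Matrix RealInnerProductSpace Real InnerProductSpace Topology Matrix.Norms.L2Operator

namespace Summit.QuantumFields.YangMills.BalabanUVNodes.N12Prop1DirectOfClassWindowUniformExplicit

open Literature.MathematicalPhysics.QuantumFieldTheory.Balaban1983to89
open T4Continuum B15DeterminingSets GaugeField B16Sect1Backgrounds B15Prop1Carrier B8Eq17ClassAkV1 BlockAveraging
open B15Prop1SliceTaylorCalculus
open B15Prop1ChartCalculusSU2 (E3)
open T4CubeChartGnomonic (SU2)
open B15Prop1ChartSU2 (su2Chart)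
open B15Prop1SliceCoordinates (GaugeSlice ιA freeBonds)
open B15Prop1AnalyticExtClause (cplxVec anExt)
open T4AdjointCovarianceUnitary (lieSU)
open T4AxialGaugeSmallField (castSite boxPlaqs boxBonds)
open B6BondElimination (unitVec)
open B6TreeGaugePoincare (curl)
open B16Eq18Proof (box mem_box)
open B15Extension193 (extend)
open B15ShellGauge193 (shellGauge)
open B14.Eq213MaximalDomains (side)
open B14.Eq213DetSet B14.Eq216Concrete B15Sect1Instances B15Eq177GaugeInvariance B15Eq177ValueInvariance B15Eq177ValueInvarianceCoDiv B16Sect1Wilson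
open B14.Eq22Determines (blockIter IsBlockUnion)
open Literature.MathematicalPhysics.QuantumFieldTheory.BalabanImbrieJaffe1984to88.BIJ85Eq453GaugeField
open Node00 (expChart msChart constrCard)
open B15Eq112TorusCover (lift)
open ExpMeanLog (deltaSU)
open Summit.QuantumFields.YangMills.BalabanUVNodes.N12Prop1DirectOfChartHalfOfRightInverseExplicit (exists_domain_prop1Printed_lfVarOn_std_su2_box_intrinsic_analytic_atZSeqCoPRecord_ofThm1TorusClass_ofMinimiserFamily_ofWindowGaugeLetter_ofChartHalfLetter_ofRightInverseLetter_explicit)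
open Summit.QuantumFields.YangMills.BalabanUVNodes.N12WindowGaugeLetterUniformSocket (hσW_on_uniform_of_class)
open B15Prop1PlaquetteLettersOfClass (hPχ_on_of_class hPbox_on_of_class)
open Node00 (SmallBelow avOfRecord regMSCoPOfRecord)

variable {F : T4Family}
/-- ★★★ **(E1)‴ `(vii)_direct` — NO LETTER ABOUT THE MINIMISER LEFT UNDER THE THRESHOLD: (D1)′ with the window gauge letter (σ)_W, the plaquette letter `hPχ` AND the tower-box plaquette letter
`hPbox` all DISCHARGED BY NAME from the (2.12) class of the minimiser** (dag-n12-w6 g7's k-UNIFORM window-LOCAL producer `hσW_on_uniform_of_class` p675589; dag-n12-c g21's `hPχ_on_of_class` ∕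
`hPbox_on_of_class` p675521 — general `Z`, NO letter off the window, NO condition on the shape of `Ω₁(Z_i)`).  Statement = (D1)′'s with the producers' rows (`c hkc hc hεreg hα3 hα2 haN X D₀ hXΩ hfit
hBox hWX hfeedsX hrad`) as binders and, inside the EXPLICIT-threshold frame `∀ δ, 0 < δ ≤ min Θ εH`, the three letters REPLACED by ONE numeric row: the k-free floor `hfloor : C(d,L)·εreg + m′·ρn i ≤ δ i`
(`εreg ≤ δ i` for the class letters follows from it since `C(d,L) ≥ 1`).  Proof: one call of (D1)′ with `hσW := hσW_on_uniform_of_class … hfloor hfloor`, `hPχ := hPχ_on_of_class …`,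
`hPbox := hPbox_on_of_class …`. [cite: Balaban1989LargeFieldI, (1.74) p.192, Prop. 1 (1.77)–(1.78) p.194, (1.79) p.195; Balaban1989LargeFieldII, p.357, (1.7)–(1.9) p.358, (1.12)–(1.13) p.359; Balaban1985Variational, (2)–(4) p.278, Thm 1 (8) p.279, (16)–(18) p.280, (44)–(48) p.285, (83) p.290; Balaban1985Averaging, Prop. 2 (52)–(53) p.26; Balaban1988Convergent, (2.2) p.255, (2.11)–(2.14) pp.256–257, (2.16) p.257] -/
theorem exists_domain_prop1Printed_lfVarOn_std_su2_box_intrinsic_analytic_atZSeqCoPRecord_ofThm1TorusClass_ofMinimiserFamily_ofClassLetters_ofWindowGaugeUniform_ofChartHalfLetter_ofRightInverseLetter_explicit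
    (ν : Node00.Stage7Numerics) (Kt : ℕ) (hd3 : 3 ≤ (F.P Kt).d) (h0 : 0 < (F.P Kt).d) {ι : Type}
    (Z Λ : ι → Set (Site (F.P Kt) 0)) (k : ι → ℕ) (M : ι → ℝ) (hk0 : ∀ i, 0 < k i) (hk1 : ∀ i, k i + 1 ≤ (F.P Kt).m + (F.P Kt).K)
    (eR : ι → ℝ) (heR : ∀ i, 0 < eR i)
    (T : ∀ i, Finset (PBond (F.P Kt) (k i)))
    (lo hi : ι → Fin (F.P Kt).d → ℤ) (n : ι → ℕ) (hn : ∀ i κ, hi i κ ≤ lo i κ + n i) (hN : ∀ i, n i + 2 < (F.P Kt).sitesPerDir (k i))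
    (hbox : ∀ i, pts (k i) (Λ i) = (castSite '' Set.Icc (lo i) (hi i) : Set (Site (F.P Kt) (k i))))
    (hZ : ∀ i, (boxPlaqs (lo i - 1) (hi i + 1) : Set (Plaq (F.P Kt) (k i))) ⊆ plaqsInside (pts (k i) (Z i)))
    (hTG0 : ∀ i, T i = (box (fun κ => (hi i κ - lo i κ + 1).toNat) (lo i)).image fun x =>
      (⟨castSite (x - unitVec ⟨0, h0⟩), ⟨0, h0⟩⟩ : PBond (F.P Kt) (k i)))
    (hN5 : ∀ i κ, ((hi i κ - lo i κ + 1).toNat : ℤ) + 5 < (F.P Kt).sitesPerDir (k i))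
    (K : ι → ℕ) (hK1 : ∀ i, 1 ≤ K i) (hKn : ∀ i κ, (hi i κ - lo i κ + 1).toNat ≤ K i)
    (ext : ∀ i, GaugeField (F.P Kt) (k i) SU2 → GaugeField (F.P Kt) (k i) SU2)
    (hext : ∀ i Vk, ext i Vk = extend (pts (k i) (Λ i)) (shellGauge Vk (lo i) (hi i)) Vk)
    (hlohi : ∀ i, lo i ≤ hi i)
    -- the REGION parallelepipeds of the normalisation and the datum tolerances
    (LO HI : ι → Fin (F.P Kt).d → ℤ) (hLO : ∀ i, LO i ≤ lo i - 1) (hHI : ∀ i, hi i + 1 ≤ HI i) (n' : ι → ℕ) (hn' : ∀ i κ, HI i κ ≤ LO i κ + n' i)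
    (hn'N : ∀ i, n' i < (F.P Kt).sitesPerDir (k i)) (hR' : ∀ i, (boxPlaqs (LO i) (HI i) : Set (Plaq (F.P Kt) (k i))) ⊆ plaqsInside (pts (k i) (Z i)))
    (ρn : ι → ℝ)
    (hρn : ∀ i, (((F.P Kt).d : ℝ) * n' i + 1) * ((((F.P Kt).d - 1 : ℕ) : ℝ) * n' i * ((12 * (F.P Kt).d * (n i + 2) ^ 2 + 1) * eR i)
      + 3 * (F.P Kt).d * (n i + 2) ^ 2 * eR i) ≤ ρn i)
    {γ cJ bx : ℝ} (hγ : 0 < γ) (hcJ : 0 ≤ cJ) (hbx : 0 ≤ bx)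
    (hbxM : ∀ i, 12 * ((F.P Kt).d : ℝ) * ((n i : ℝ) + 2) ^ 2 ≤ bx * (M i) ^ 2)
    {R 𝓐₀ : ι → ℝ} (hM : ∀ i, 1 ≤ (M i)) (hR : ∀ i, 0 < R i) (h𝓐₀ : ∀ i, 0 ≤ 𝓐₀ i)
    -- (J0′), R-EXPLICIT: per instance one radius and one bound for every base field of the strict guard
    (hMin : ∀ i Vk, PlaqSmallOn (plaqsInside (pts (k i) (Z i ∩ (Λ i)ᶜ))) (eR i) Vk →
      ∃ Ũ : VecField (F.P Kt) (k i) (EuclideanSpace ℂ (Fin 3)) × VecField (F.P Kt) (k i) (EuclideanSpace ℂ (Fin 3)) →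
          PBond (F.P Kt) 0 → Matrix (Fin 2) (Fin 2) ℂ,
        (∀ b a c, DifferentiableOn ℂ (fun z => Ũ z b a c) (ball 0 (R i))) ∧
        (∀ z ∈ ball (0 : VecField (F.P Kt) (k i) (EuclideanSpace ℂ (Fin 3)) × VecField (F.P Kt) (k i) (EuclideanSpace ℂ (Fin 3))) (R i),
          ∀ b a c, ‖Ũ z b a c‖ ≤ 𝓐₀ i) ∧
        ∀ p B' : VecField (F.P Kt) (k i) E3, ‖p‖ < R i → ‖B'‖ < R i → ∃ U' : GaugeField (F.P Kt) 0 SU2,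
          (∀ b, Ũ (cplxVec p, cplxVec B') b = ((U' b : SU2) : Matrix (Fin 2) (Fin 2) ℂ)) ∧
            IsMinimizer (Node00.avOfRecord F 2 Kt) (Node00.regMSCoPOfRecord F 2 ν Kt (k i) (maxDomT ν.M₁ (Z i))) (Bj ν.M₁ (Z i) (k i))
              (avgFamily (Node00.avOfRecord F 2 Kt) (qsstarGIter0 (k i) (expMul su2Chart B' (ext i (expMul su2Chart p Vk))))) U')
    -- dag-n12-w4's GEOMETRY letter of the chart file (the window box and its two shifts inside `Ω_k(Z)`)
    (hΩw : ∀ i, ∀ (ν' : Fin (F.P Kt).d), ∀ z ∈ box (fun κ => (hi i κ - lo i κ + 1).toNat + 3) (fun κ => lo i κ - 2),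
      (castSite z : Site (F.P Kt) (k i)) ∈ pts (k i) (maxDomT ν.M₁ (Z i) (k i)) ∧
        (castSite z : Site (F.P Kt) (k i)).shift ⟨0, h0⟩ ∈ pts (k i) (maxDomT ν.M₁ (Z i) (k i)) ∧
        (castSite z : Site (F.P Kt) (k i)).shift ν' ∈ pts (k i) (maxDomT ν.M₁ (Z i) (k i)))
    -- the WINDOW per instance, containing every plaquette whose source lies in the fine image of the enlarged window box (the chart half's `hW`)
    (W : ι → Finset (Plaq (F.P Kt) 0))
    (hWbox : ∀ i, ∀ q : Plaq (F.P Kt) 0, q.src ∈ ((box (fun κ => (F.P Kt).L ^ (k i) * ((hi i κ - lo i κ + 1).toNat + 3 + 1) - 1) (fun κ => ((F.P Kt).L : ℤ) ^ (k i) * (lo i κ - 2))).image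
        (fun z => (castSite z : Site (F.P Kt) 0))) → q ∈ W i)
    -- dag-n12-w6 g7's k-UNIFORM WINDOW-LOCAL (σ)_W producer `N12WindowGaugeLetterUniformSocket.hσW_on_uniform_of_class` (general `Z`, no letter off the window, tolerance `C(d,L)·εreg + m′·ρn`
    -- INDEPENDENT of `k`): its NUMERICS per instance (level guard `k + c ≤ m + K` with `4d + m′ + 3 < 2L^c`), the class threshold `εreg` positive and Prop. 2-small, the WINDOW `X i` within
    -- walk-distance `D₀ i` of `Ω_{k_i}(Z_i)` (`hXΩ`) with the collar fit `hfit`, the REGION-BOX ROW `hBox` and the two window rows `hWX hfeedsX`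
    (c : ι → ℕ) (hkc : ∀ i, k i + c i ≤ (F.P Kt).m + (F.P Kt).K) (hc : ∀ i, 4 * (F.P Kt).d + (3 * ((F.P Kt).d * (((F.P Kt).L - 1) / 2)) + 5) + 3 < 2 * (F.P Kt).L ^ c i)
    (hεreg : 0 < ν.εreg)
    (hα3 : (143 * (((((F.P Kt).d + 4 : ℕ) : ℝ)) ^ 2 / 4) ^ 2) * (ν.εreg * (F.P Kt).L ^ 2) ≤ 1 / 3)
    (hα2 : 2 * (ν.εreg * (F.P Kt).L ^ 2) ≤ 2 * deltaSU (Fin 2) / ((((F.P Kt).d + 4) * (F.P Kt).L : ℕ) : ℝ) ^ 2)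
    (haN : (((((F.P Kt).d + 2) * (F.P Kt).L : ℕ) : ℝ) ^ 2 / 4) * (2 * (ν.εreg * (F.P Kt).L ^ 2)) < deltaSU (Fin 2))
    (X : ι → Set (Site (F.P Kt) 0)) (D₀ : ι → ℕ)
    (hXΩ : ∀ i, ∀ x ∈ X i, ∃ x₀ ∈ maxDomT ν.M₁ (Z i) (k i), ∃ w₀ : List (Letter (F.P Kt).d), w₀.length ≤ D₀ i ∧ walkEnd x₀ w₀ = x)
    (hfit : ∀ i, D₀ i + 3 * (∑ i' ∈ Finset.range (k i + 1), ((F.P Kt).d * (((F.P Kt).L ^ i' - 1) / 2) + 1)) + ((3 * ((F.P Kt).d * (((F.P Kt).L - 1) / 2)) + 5) + 5) * (F.P Kt).L ^ k i +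
      (((F.P Kt).d + 4) * (F.P Kt).L + 2) * (∑ l ∈ Finset.Ico 0 (k i), (F.P Kt).L ^ l) + 4 ≤ (F.P Kt).L ^ (k i - 1) * ν.M₁)
    (hBox : ∀ i, ∀ x ∈ X i, ∀ w : List (Letter (F.P Kt).d),
      w.length ≤ (∑ i' ∈ Finset.range (k i + 1), ((F.P Kt).d * (((F.P Kt).L ^ i' - 1) / 2) + 1)) + (3 * ((F.P Kt).d * (((F.P Kt).L - 1) / 2)) + 5) * (F.P Kt).L ^ k i + (F.P Kt).L ^ k i →
      ∀ μ : Fin (F.P Kt).d, (⟨blockIter (k i) (walkEnd x w), μ⟩ : PBond (F.P Kt) (k i)) ∈ (boxBonds (LO i) (HI i) : Set (PBond (F.P Kt) (k i))))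
    (hWX : ∀ i, ∀ p ∈ W i, p.src ∈ X i ∧ p.src.shift p.μ ∈ X i ∧ p.src.shift p.ν ∈ X i ∧ (p.src.shift p.μ).shift p.ν ∈ X i ∧ (p.src.shift p.ν).shift p.μ ∈ X i)
    (hfeedsX : ∀ i (ν' : Fin (F.P Kt).d), ∀ z ∈ box (fun κ => (hi i κ - lo i κ + 1).toNat + 3) (fun κ => lo i κ - 2), ∀ b₀ : PBond (F.P Kt) 0,
      (b₀ ∈ feeds (k i) (⟨(castSite z : Site (F.P Kt) (k i)), ⟨0, h0⟩⟩ : PBond (F.P Kt) (k i)) ∨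
        b₀ ∈ feeds (k i) (⟨((castSite z : Site (F.P Kt) (k i))).shift ⟨0, h0⟩, ν'⟩ : PBond (F.P Kt) (k i)) ∨
        b₀ ∈ feeds (k i) (⟨((castSite z : Site (F.P Kt) (k i))).shift ν', ⟨0, h0⟩⟩ : PBond (F.P Kt) (k i)) ∨
        b₀ ∈ feeds (k i) (⟨(castSite z : Site (F.P Kt) (k i)), ν'⟩ : PBond (F.P Kt) (k i))) → b₀.src ∈ X i ∧ b₀.tgt ∈ X i)
    -- the tower-box radius fits the cube side (for the class reading of `hPbox`, dag-n12-c g21's `hPbox_on_of_class`)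
    (hrad : (F.P Kt).L + ((F.P Kt).L - 1) / 2 ≤ ν.M₁)
    -- THE CHART HALF, DISPLAYED (LOCATED-FLOOR): its four per-height constants as BINDERS and ONE letter = the ∀-body of `exists_hWD_chartHalf_of_letters'` ∕ `_uniform` at height
    -- `k i` (with `ν Z Λ T lo hi` quantified INSIDE, so that `choose … exists_hWD_chartHalf_of_letters_uniform Kt h0 (hk0 i) (hk i)` discharges it term-for-term BEFORE `ν` is fixed)
    (C ρ Kτ ρτ : ι → ℝ) (hρ : ∀ i, 0 < ρ i) (hKτ : ∀ i, 0 ≤ Kτ i) (hρτ : ∀ i, 0 < ρτ i)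
    (hhalf : ∀ i,
        ∀ (ν : Node00.Stage7Numerics) (Z Λ : Set (Site (F.P Kt) 0)) (T : Finset (PBond (F.P Kt) (k i))) (lo hi : Fin (F.P Kt).d → ℤ),
        (∀ κ, ((((hi κ - lo κ + 1).toNat + 3 : ℕ) : ℤ)) ≤ (F.P Kt).sitesPerDir (k i)) →
        (∀ (ν' : Fin (F.P Kt).d), ∀ z ∈ box (fun κ => (hi κ - lo κ + 1).toNat + 3) (fun κ => lo κ - 2),
          (castSite z : Site (F.P Kt) (k i)) ∈ pts (k i) (maxDomT ν.M₁ Z (k i)) ∧ (castSite z : Site (F.P Kt) (k i)).shift ⟨0, h0⟩ ∈ pts (k i) (maxDomT ν.M₁ Z (k i)) ∧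
            (castSite z : Site (F.P Kt) (k i)).shift ν' ∈ pts (k i) (maxDomT ν.M₁ Z (k i))) →
        ∀ (ext : GaugeField (F.P Kt) (k i) SU2 → GaugeField (F.P Kt) (k i) SU2) (Vk : GaugeField (F.P Kt) (k i) SU2) ⦃R 𝓐₀ : ℝ⦄, 0 < R → 0 ≤ 𝓐₀ →
        ∀ (U₀ : GaugeField (F.P Kt) 0 SU2) (Xf : GaugeSlice (pts (k i) Λ) T E3 → PBond (F.P Kt) 0 → lieSU (Fin 2)),
        IsMinimizer (Node00.avOfRecord F 2 Kt) (Node00.regMSCoPOfRecord F 2 ν Kt (k i) (maxDomT ν.M₁ Z)) (Bj ν.M₁ Z (k i))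
          (avgFamily (Node00.avOfRecord F 2 Kt) (qsstarGIter0 (k i) (ext Vk))) U₀ →
        SmallBelow (Node00.avOfRecord F 2 Kt) (k i) U₀ →
        ∀ ⦃εP : ℝ⦄, 0 ≤ εP →
        (∀ p : Plaq (F.P Kt) 0, ((⟨p.src, p.μ⟩ : PBond (F.P Kt) 0) ∈ {b : PBond (F.P Kt) 0 | b.src ∈ maxDomT ν.M₁ Z 1} ∨
            (⟨p.src.shift p.μ, p.ν⟩ : PBond (F.P Kt) 0) ∈ {b : PBond (F.P Kt) 0 | b.src ∈ maxDomT ν.M₁ Z 1} ∨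
            (⟨p.src.shift p.ν, p.μ⟩ : PBond (F.P Kt) 0) ∈ {b : PBond (F.P Kt) 0 | b.src ∈ maxDomT ν.M₁ Z 1} ∨
            (⟨p.src, p.ν⟩ : PBond (F.P Kt) 0) ∈ {b : PBond (F.P Kt) 0 | b.src ∈ maxDomT ν.M₁ Z 1}) →
          ‖((GaugeField.plaqHol U₀ p : SU2) : Matrix (Fin 2) (Fin 2) ℂ) - 1‖ ≤ εP) →
        ∀ (H : (Fin (constrCard (Bj ν.M₁ Z (k i)) (k i)) → lieSU (Fin 2)) → PBond (F.P Kt) 0 → lieSU (Fin 2)) ⦃B : ℝ⦄, 0 ≤ B →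
        (∀ v, fderiv ℝ (msChart F 2 Kt (k i) (Bj ν.M₁ Z (k i)) (avgFamily (avOfRecord F 2 Kt) (qsstarGIter0 (k i) (ext Vk))) U₀) 0 (H v) = v) →
        (∀ v, Real.sqrt (∑ b, ‖H v b‖ ^ 2) ≤ B * ‖v‖) →
        ∀ ⦃M₂ : ℝ⦄, 0 ≤ M₂ → (∀ w, ‖fderiv ℝ (fderiv ℝ (msChart F 2 Kt (k i) (Bj ν.M₁ Z (k i)) (avgFamily (avOfRecord F 2 Kt) (qsstarGIter0 (k i) (ext Vk))) U₀)) 0 w w‖ ≤ M₂ * ‖w‖ ^ 2) →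
        Xf 0 = 0 → ContDiffAt ℝ 2 Xf 0 →
        (∀ᶠ Y in 𝓝 (0 : GaugeSlice (pts (k i) Λ) T E3),
          IsMinimizer (Node00.avOfRecord F 2 Kt) (Node00.regMSCoPOfRecord F 2 ν Kt (k i) (maxDomT ν.M₁ Z)) (Bj ν.M₁ Z (k i))
            (avgFamily (Node00.avOfRecord F 2 Kt) (qsstarGIter0 (k i) (expMul su2Chart (ιA (pts (k i) Λ) T Y) (ext Vk)))) (expChart U₀ (Xf Y))) →
        (∀ (X : GaugeSlice (pts (k i) Λ) T E3) (b : PBond (F.P Kt) 0),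
          ‖((fderiv ℝ Xf 0 X b : lieSU (Fin 2)) : Matrix (Fin 2) (Fin 2) ℂ)‖ ≤ 8 * 𝓐₀ / R * ‖X‖ ∧ ‖fderiv ℝ Xf 0 X b‖ ≤ 12 * 𝓐₀ / R * ‖X‖) →
        (∀ (X : GaugeSlice (pts (k i) Λ) T E3) (b : PBond (F.P Kt) 0), b.src ∉ maxDomT ν.M₁ Z 1 → fderiv ℝ Xf 0 X b = 0) →
        ∀ (W : Finset (Plaq (F.P Kt) 0)),
        (∀ q : Plaq (F.P Kt) 0, q.src ∈ ((box (fun κ => (F.P Kt).L ^ (k i) * ((hi κ - lo κ + 1).toNat + 3 + 1) - 1) (fun κ => ((F.P Kt).L : ℤ) ^ (k i) * (lo κ - 2))).image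
            (fun z => (castSite z : Site (F.P Kt) 0))) → q ∈ W) →
        ∀ ⦃δW : ℝ⦄, 0 < δW → δW < (ρ i) → δW < (ρτ i) →
        (∀ (ν' : Fin (F.P Kt).d), ∀ z ∈ box (fun κ => (hi κ - lo κ + 1).toNat + 3) (fun κ => lo κ - 2), ∀ b₀ : PBond (F.P Kt) 0,
          (b₀ ∈ feeds (k i) (⟨(castSite z : Site (F.P Kt) (k i)), ⟨0, h0⟩⟩ : PBond (F.P Kt) (k i)) ∨ b₀ ∈ feeds (k i) (⟨((castSite z : Site (F.P Kt) (k i))).shift ⟨0, h0⟩, ν'⟩ : PBond (F.P Kt) (k i))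
          ∨ b₀ ∈ feeds (k i) (⟨((castSite z : Site (F.P Kt) (k i))).shift ν', ⟨0, h0⟩⟩ : PBond (F.P Kt) (k i)) ∨ b₀ ∈ feeds (k i) (⟨(castSite z : Site (F.P Kt) (k i)), ν'⟩ : PBond (F.P Kt) (k i))) →
          ‖((U₀ b₀ : SU2) : Matrix (Fin 2) (Fin 2) ℂ) - 1‖ ≤ δW) →
        ∃ (Ψ₂ : (PBond (F.P Kt) 0 → lieSU (Fin 2)) →L[ℝ] (PBond (F.P Kt) 0 → lieSU (Fin 2)) →L[ℝ] (Fin (constrCard (Bj ν.M₁ Z (k i)) (k i)) → lieSU (Fin 2)))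
          (lam : (Fin (constrCard (Bj ν.M₁ Z (k i)) (k i)) → lieSU (Fin 2)) →L[ℝ] ℝ)
          (p : Seminorm ℝ (PBond (F.P Kt) 0 → lieSU (Fin 2))),
          HasFDerivAt (fun Y => fderiv ℝ (msChart F 2 Kt (k i) (Bj ν.M₁ Z (k i)) (avgFamily (avOfRecord F 2 Kt) (qsstarGIter0 (k i) (ext Vk))) U₀) Y) Ψ₂ 0 ∧
          (∀ᶠ Y in 𝓝 (0 : PBond (F.P Kt) 0 → lieSU (Fin 2)), DifferentiableAt ℝ (msChart F 2 Kt (k i) (Bj ν.M₁ Z (k i)) (avgFamily (avOfRecord F 2 Kt) (qsstarGIter0 (k i) (ext Vk))) U₀) Y) ∧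
          fderiv ℝ (fun Y : PBond (F.P Kt) 0 → lieSU (Fin 2) => wilsonAction4 (expChart U₀ Y)) 0 = lam.comp (fderiv ℝ (msChart F 2 Kt (k i) (Bj ν.M₁ Z (k i)) (avgFamily (avOfRecord F 2 Kt) (qsstarGIter0 (k i) (ext Vk))) U₀) 0) ∧
          (∀ Y : PBond (F.P Kt) 0 → lieSU (Fin 2), ∑ b, ‖(Y b : Matrix (Fin 2) (Fin 2) ℂ)‖ ^ 2 ≤ p Y ^ 2) ∧
          ∀ X : GaugeSlice (pts (k i) Λ) T E3,
            lam (Ψ₂ (fderiv ℝ Xf 0 X) (fderiv ℝ Xf 0 X))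
                ≤ (2 * (((F.P Kt).d : ℝ) - 1) * εP * Real.sqrt (Fintype.card (PBond (F.P Kt) 0)) * B * M₂) * p (fderiv ℝ Xf 0 X) ^ 2 ∧
            p (fderiv ℝ Xf 0 X) ≤ (12 * 𝓐₀ / R * Real.sqrt (Nat.card {b : PBond (F.P Kt) 0 // b.src ∈ maxDomT ν.M₁ Z 1})) * ‖X‖ ∧
            (((F.P Kt).L : ℝ) ^ (F.P Kt).d) ^ (k i) / ((((F.P Kt).L : ℝ)) ^ 2 * ((F.P Kt).L : ℝ) ^ 2) ^ (k i) / 2 * (∑ z ∈ box (fun κ => (hi κ - lo κ + 1).toNat + 3) (fun κ => lo κ - 2), ∑ μ : Fin (F.P Kt).d, ∑ a : Fin 3, curl (fun b => ιA (pts (k i) Λ) T X (⟨castSite b.1, b.2⟩ : PBond (F.P Kt) (k i)) a) z ⟨0, h0⟩ μ ^ 2)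
                - (((F.P Kt).L : ℝ) ^ (F.P Kt).d) ^ (k i) / ((((F.P Kt).L : ℝ)) ^ 2 * ((F.P Kt).L : ℝ) ^ 2) ^ (k i) * (8 * (((F.P Kt).d : ℝ) + 1) * (2 * ((Kτ i) + 1) * δW) + 8 * ((F.P Kt).d : ℝ) * (((box (fun κ => (hi κ - lo κ + 1).toNat + 3) (fun κ => lo κ - 2)).image (fun z => (castSite z : Site (F.P Kt) (k i)))).card : ℝ) * ((C i) * δW * (12 * 𝓐₀ / R * Real.sqrt (Nat.card {b : PBond (F.P Kt) 0 // b.src ∈ maxDomT ν.M₁ Z 1}))) ^ 2) * ‖X‖ ^ 2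
              ≤ ((Fintype.card (Fin 2) : ℝ)⁻¹ • ∑ p ∈ W, (innerSL ℝ (E := lieSU (Fin 2))).bilinearComp
                (ContinuousLinearMap.proj (R := ℝ) (φ := fun _ : PBond (F.P Kt) 0 => lieSU (Fin 2)) (⟨p.src, p.μ⟩ : PBond (F.P Kt) 0) + ContinuousLinearMap.proj (R := ℝ) (φ := fun _ : PBond (F.P Kt) 0 => lieSU (Fin 2)) (⟨p.src.shift p.μ, p.ν⟩ : PBond (F.P Kt) 0)
                  - ContinuousLinearMap.proj (R := ℝ) (φ := fun _ : PBond (F.P Kt) 0 => lieSU (Fin 2)) (⟨p.src.shift p.ν, p.μ⟩ : PBond (F.P Kt) 0) - ContinuousLinearMap.proj (R := ℝ) (φ := fun _ : PBond (F.P Kt) 0 => lieSU (Fin 2)) (⟨p.src, p.ν⟩ : PBond (F.P Kt) 0) : (PBond (F.P Kt) 0 → lieSU (Fin 2)) →L[ℝ] lieSU (Fin 2))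
                (ContinuousLinearMap.proj (R := ℝ) (φ := fun _ : PBond (F.P Kt) 0 => lieSU (Fin 2)) (⟨p.src, p.μ⟩ : PBond (F.P Kt) 0) + ContinuousLinearMap.proj (R := ℝ) (φ := fun _ : PBond (F.P Kt) 0 => lieSU (Fin 2)) (⟨p.src.shift p.μ, p.ν⟩ : PBond (F.P Kt) 0)
                  - ContinuousLinearMap.proj (R := ℝ) (φ := fun _ : PBond (F.P Kt) 0 => lieSU (Fin 2)) (⟨p.src.shift p.ν, p.μ⟩ : PBond (F.P Kt) 0) - ContinuousLinearMap.proj (R := ℝ) (φ := fun _ : PBond (F.P Kt) 0 => lieSU (Fin 2)) (⟨p.src, p.ν⟩ : PBond (F.P Kt) 0) : (PBond (F.P Kt) 0 → lieSU (Fin 2)) →L[ℝ] lieSU (Fin 2))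
                : (PBond (F.P Kt) 0 → lieSU (Fin 2)) →L[ℝ] (PBond (F.P Kt) 0 → lieSU (Fin 2)) →L[ℝ] ℝ) (fderiv ℝ Xf 0 X) (fderiv ℝ Xf 0 X))
    -- THE (P4)′ PRODUCER's TWO CONSTANTS PER INSTANCE, AS BINDERS (its `ε` per height, its `B` per `(M₁, Z)` — never after `εreg`∕`ρn`), and its LETTER `hHB` displayed: the ∀-body of
    -- dag-n12-w6's `N12DirectSurjHsurj.exists_rightInverse_letter` at `(2, Kt, k i, ν.M₁, Z i; εH i, B i)` (inhabited by p664681 — §2); the chart-curvature constant (P5) `M₂`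
    (εH B M₂ : ι → ℝ) (hB0 : ∀ i, 0 ≤ B i) (hM₂0 : ∀ i, 0 ≤ M₂ i)
    (hHB : ∀ i (Wd : MSField (F.P Kt) SU2) (U₀ : GaugeField (F.P Kt) 0 SU2),
      AgreeOn (Bj ν.M₁ (Z i) (k i)) (avgFamily (Node00.avOfRecord F 2 Kt) U₀) Wd → Node00.SmallBelow (Node00.avOfRecord F 2 Kt) (k i) U₀ →
      (∀ (j : ℕ), 1 ≤ j → j ≤ k i → ∀ y : Site (F.P Kt) j, embIter j y ∈ maxDomT ν.M₁ (Z i) j →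
        PlaqSmallOn (boxPlaqs (fun κ => lift (F.P Kt) (embIter j y) κ - ((((F.P Kt).L ^ j : ℕ) : ℤ) + ((((F.P Kt).L ^ j - 1) / 2 : ℕ) : ℤ)))
          (fun κ => lift (F.P Kt) (embIter j y) κ + ((((F.P Kt).L ^ j : ℕ) : ℤ) + ((((F.P Kt).L ^ j - 1) / 2 : ℕ) : ℤ))) : Set (Plaq (F.P Kt) 0)) (εH i) U₀) →
      ∃ H : (Fin (constrCard (Bj ν.M₁ (Z i) (k i)) (k i)) → lieSU (Fin 2)) → PBond (F.P Kt) 0 → lieSU (Fin 2),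
        (∀ v, fderiv ℝ (msChart F 2 Kt (k i) (Bj ν.M₁ (Z i) (k i)) Wd U₀) 0 (H v) = v) ∧ ∀ v, Real.sqrt (∑ b, ‖H v b‖ ^ 2) ≤ B i * ‖v‖)
    -- DISPLAYED per guarded base field ∕ minimiser: the small-below letter and the chart-curvature letter (P5) — the (P4)′ socket is DISCHARGED by `hHB` ∘ (fibre clause, `hsb`, `hPbox`)
    (hsb : ∀ i (Vk : GaugeField (F.P Kt) (k i) SU2), PlaqSmallOn (plaqsInside (pts (k i) (Z i ∩ (Λ i)ᶜ))) (eR i) Vk →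
      (∀ b ∈ (boxBonds (LO i) (HI i) : Set (PBond (F.P Kt) (k i))), dist1 (ext i Vk b) ≤ ρn i) →
      ∀ U₀ : GaugeField (F.P Kt) 0 SU2,
        IsMinimizer (Node00.avOfRecord F 2 Kt) (Node00.regMSCoPOfRecord F 2 ν Kt (k i) (maxDomT ν.M₁ (Z i))) (Bj ν.M₁ (Z i) (k i))
          (avgFamily (Node00.avOfRecord F 2 Kt) (qsstarGIter0 (k i) (ext i Vk))) U₀ →
        Node00.SmallBelow (Node00.avOfRecord F 2 Kt) (k i) U₀)
    (hM₂ : ∀ i (Vk : GaugeField (F.P Kt) (k i) SU2), PlaqSmallOn (plaqsInside (pts (k i) (Z i ∩ (Λ i)ᶜ))) (eR i) Vk →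
      (∀ b ∈ (boxBonds (LO i) (HI i) : Set (PBond (F.P Kt) (k i))), dist1 (ext i Vk b) ≤ ρn i) →
      ∀ U₀ : GaugeField (F.P Kt) 0 SU2,
        IsMinimizer (Node00.avOfRecord F 2 Kt) (Node00.regMSCoPOfRecord F 2 ν Kt (k i) (maxDomT ν.M₁ (Z i))) (Bj ν.M₁ (Z i) (k i))
          (avgFamily (Node00.avOfRecord F 2 Kt) (qsstarGIter0 (k i) (ext i Vk))) U₀ →
        ∀ w, ‖fderiv ℝ (fderiv ℝ (msChart F 2 Kt (k i) (Bj ν.M₁ (Z i) (k i)) (avgFamily (Node00.avOfRecord F 2 Kt) (qsstarGIter0 (k i) (ext i Vk))) U₀)) 0 w w‖ ≤ M₂ i * ‖w‖ ^ 2)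
    -- numerics: the positivity constant fits (`γ₀ := 1∕2`: the chart half's level factor `((L^d)^k∕(L²·L²)^k)∕2` at `d = 4`)
    (hγle : ∀ i, γ / (M i) ^ 5 ≤ 1 / 2 / (2 * (3 * (K i : ℝ) ^ 2 + 2 * (K i : ℝ) ^ 4)))
    (hfar : ∀ i (b : PBond (F.P Kt) 0), b.src ∉ maxDomT ν.M₁ (Z i) 1 →
      (⟨blockIter (k i) b.src, b.dir⟩ : PBond (F.P Kt) (k i)) ∉ bondsOf (pts (k i) (Λ i)))
    (hZblk : ∀ i, IsBlockUnion (k i) (Z i))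
    (hM2 : 2 ≤ ν.M₁) (hdiv : ∀ i, side (F.P Kt).L ν.M₁ (k i) ∣ (F.P Kt).sitesPerDir 0)
    {cE B₃ a₀ a₁' cA : ℝ} (hcE0 : 0 ≤ cE) (hcE : ∀ i, 12 * ((F.P Kt).d : ℝ) * ((n i : ℝ) + 2) ^ 2 ≤ cE) (hB₃ : 0 ≤ B₃)
    (heRa : ∀ i, (cE + 1) * eR i ≤ a₁' ∧ B₃ * ((cE + 1) * eR i) ≤ ν.εreg) (ha₀ : ν.εreg ≤ a₀)
    (hcA : 1 / 2 * (B₃ * (cE + 1) * (F.P Kt).eta 1 ^ 2) ^ 2 * (Fintype.card (Plaq (F.P Kt) 0) : ℝ) ≤ cA)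
    (h15T : ∀ (k' : ℕ), k' ≤ (F.P Kt).m + (F.P Kt).K → side (F.P Kt).L ν.M₁ k' ∣ (F.P Kt).sitesPerDir 0 →
      ∀ (s : B14.Eq218Concrete.Seq (fun n : ℕ => Node00.unionsOfCubes (F.P Kt) (side (F.P Kt).L ν.M₁ n)) k'),
      Node00.Sect2.SeqSeparated ν.M₁ s → 0 < ν.M₁ →
      ∀ (ε₀ : ℝ) (δ : ℕ → ℝ), (∀ j, j ≤ k' → 0 < δ j ∧ δ j ≤ a₁' ∧ B₃ * δ j ≤ ε₀) → (∀ j, j < k' → δ j ≤ 2 * δ (j + 1)) →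
      (∀ j, j < k' → δ (j + 1) ≤ 2 * δ j) → ε₀ ≤ a₀ →
      ∀ W : MSField (F.P Kt) SU2,
        Node00.Sect2.DataSmall7PTop (Node00.avOfRecord F 2 Kt) s.Ω (Node00.suppDomOfRecord F ν Kt s.Ω) k' δ W →
        ∀ U₀ : GaugeField (F.P Kt) 0 SU2, IsMinimizer (Node00.avOfRecord F 2 Kt)
            {U | (∀ j, j ≤ k' → PlaqSmallOn (Node00.Sect2.omegaPlaqsTop s.Ω (Node00.suppDomOfRecord F ν Kt s.Ω) j)
                (ε₀ * (F.P Kt).eta j ^ 2) U) ∧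
              Node00.Sect2.CoDivClassOnTop s.Ω (Node00.suppDomOfRecord F ν Kt s.Ω) k' ε₀ U}
            (genSet s.Ω k') W U₀ →
          (∀ j, j ≤ k' → PlaqSmallOn (Node00.Sect2.omegaPlaqsTop s.Ω (Node00.suppDomOfRecord F ν Kt s.Ω) j)
              (B₃ * δ j * (F.P Kt).eta j ^ 2) U₀) ∧
            ∀ j, j ≤ k' → Node00.Sect2.CoDivSmallOn (Node00.Sect2.omegaBondsTop s.Ω (Node00.suppDomOfRecord F ν Kt s.Ω) j)
              (B₃ * δ j * (F.P Kt).eta j ^ 3) U₀)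
    (hcJ' : ∀ i, 2 * cA * eR i / R i + 4 * ((Fintype.card (Plaq (F.P Kt) 0) : ℝ) * (1 + 8 * 𝓐₀ i ^ 4)) / (R i * eR i) ≤ cJ)
    -- THE EXPLICIT-THRESHOLD FRAME (no `∃ δ₀`): tolerances below `Θ i := min (min (ρ i) (ρτ i) ∕ 2) (min 1 (rhs_i ∕ (max S_i 0 + 1)))`, every symbol a binder or a cardinality
    : ∀ δ : ι → ℝ, (∀ i, 0 < δ i) →
      (∀ i, δ i ≤ min (min (min (ρ i) (ρτ i) / 2)
        (min 1 (1 / 2 / (2 * (3 * (K i : ℝ) ^ 2 + 2 * (K i : ℝ) ^ 4)) /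
          (max ((32 * (((F.P Kt).d : ℝ) - 1) + 8 * (((F.P Kt).d : ℝ) - 1) + (2 * (((F.P Kt).d : ℝ) - 1) * Real.sqrt (Fintype.card (PBond (F.P Kt) 0)) * B i * M₂ i)) * (12 * 𝓐₀ i / R i * Real.sqrt (Nat.card {b : PBond (F.P Kt) 0 // b.src ∈ maxDomT ν.M₁ (Z i) 1})) ^ 2
            + (8 * (((F.P Kt).d : ℝ) + 1) * (2 * (Kτ i + 1)) + 8 * ((F.P Kt).d : ℝ) * (((box (fun κ => (hi i κ - lo i κ + 1).toNat + 3) (fun κ => lo i κ - 2)).image (fun z => (castSite z : Site (F.P Kt) (k i)))).card : ℝ) * (C i * (12 * 𝓐₀ i / R i * Real.sqrt (Nat.card {b : PBond (F.P Kt) 0 // b.src ∈ maxDomT ν.M₁ (Z i) 1}))) ^ 2)) 0 + 1)))) (εH i)) →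
      -- (σ)_W, THE PLAQUETTE LETTER AND THE TOWER-BOX PLAQUETTE LETTER ALL DISCHARGED FROM THE CLASS (dag-n12-w6 g7's k-UNIFORM window-LOCAL producer `hσW_on_uniform_of_class`,
      -- dag-n12-c g21's `hPχ_on_of_class` ∕ `hPbox_on_of_class`, at tolerance `δ i`, `ε := εreg`): the ONLY row left under the threshold is the producer's k-FREE TOLERANCE FLOOR —
      -- `(((4d+m′+3)²L²∕4) + m′·24(((d+2)L)²∕4))·εreg + m′·ρn i ≤ δ i` (with `δ i` below the EXPLICIT threshold above: a checkable smallness condition on the class threshold `εreg` and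
      -- the datum tolerance `ρn i`, uniform in the height `k` — the direct road's displayed price)
      ∀ (hfloor : ∀ i, ((((4 * (F.P Kt).d + (3 * ((F.P Kt).d * (((F.P Kt).L - 1) / 2)) + 5) + 3 : ℕ) : ℝ)) ^ 2 * ((F.P Kt).L : ℝ) ^ 2 / 4 + ((3 * ((F.P Kt).d * (((F.P Kt).L - 1) / 2)) + 5 : ℕ) : ℝ) * (24 * (((((F.P Kt).d + 2) * (F.P Kt).L : ℕ) : ℝ) ^ 2 / 4))) * ν.εreg + ((3 * ((F.P Kt).d * (((F.P Kt).L - 1) / 2)) + 5 : ℕ) : ℝ) * ρn i ≤ δ i),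
      ∃ a₁ : ι → ℝ, (∀ i, 0 < a₁ i) ∧
      B15.Prop1Printed (lfVarOn su2Chart fun i =>
        InstOn.std (Node00.bgMSCoPOfRecord F 2 ν Kt (k i) (maxDomT ν.M₁ (Z i))) ν.M₁ (Z i) (Λ i) (k i) (M i) (a₁ i)
          (anExt (pts (k i) (Λ i)) (T i)
            (fun177std (Node00.bgMSCoPOfRecord F 2 ν Kt (k i) (maxDomT ν.M₁ (Z i))) ν.M₁ (Z i) (k i)) (ext i)
            (min (1 / 2) (min (R i / 8) (γ / (M i) ^ 5 * (R i / 2) ^ 2 /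
              (48 * (4 * ((Fintype.card (Plaq (F.P Kt) 0) : ℝ) * (1 + 8 * 𝓐₀ i ^ 4)) / R i + 1))))))) := by
  have hk : ∀ i, k i ≤ (F.P Kt).m + (F.P Kt).K := fun i => Nat.le_of_succ_le (hk1 i)
  have hρn0 : ∀ i, 0 ≤ ρn i := fun i => le_trans (by have := heR i; positivity) (hρn i)
  intro δ hδpos hδle hfloor
  -- the class letters' tolerance condition `εreg ≤ δ i` from the floor (its `εreg`-coefficient is `≥ 1`)
  have hδε : ∀ i, ν.εreg ≤ δ i := fun i => by
    have hm : (0 : ℝ) ≤ ((3 * ((F.P Kt).d * (((F.P Kt).L - 1) / 2)) + 5 : ℕ) : ℝ) * ρn i := mul_nonneg (Nat.cast_nonneg _) (hρn0 i)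
    have h8 : (8 : ℝ) ≤ (((4 * (F.P Kt).d + (3 * ((F.P Kt).d * (((F.P Kt).L - 1) / 2)) + 5) + 3 : ℕ) : ℝ)) := by
      have h : 8 ≤ 4 * (F.P Kt).d + (3 * ((F.P Kt).d * (((F.P Kt).L - 1) / 2)) + 5) + 3 := by omega
      exact_mod_cast h
    have hL1 : (1 : ℝ) ≤ ((F.P Kt).L : ℝ) := by exact_mod_cast Nat.succ_le_of_lt (F.P Kt).L_pos
    have hB : (0 : ℝ) ≤ ((3 * ((F.P Kt).d * (((F.P Kt).L - 1) / 2)) + 5 : ℕ) : ℝ) * (24 * (((((F.P Kt).d + 2) * (F.P Kt).L : ℕ) : ℝ) ^ 2 / 4)) := by positivity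
    have hAL : (8 : ℝ) * 1 ≤ (((4 * (F.P Kt).d + (3 * ((F.P Kt).d * (((F.P Kt).L - 1) / 2)) + 5) + 3 : ℕ) : ℝ)) * ((F.P Kt).L : ℝ) := mul_le_mul h8 hL1 zero_le_one (by positivity)
    have h64 : (8 : ℝ) * 1 * (8 * 1) ≤ (((4 * (F.P Kt).d + (3 * ((F.P Kt).d * (((F.P Kt).L - 1) / 2)) + 5) + 3 : ℕ) : ℝ)) * ((F.P Kt).L : ℝ) * ((((4 * (F.P Kt).d + (3 * ((F.P Kt).d * (((F.P Kt).L - 1) / 2)) + 5) + 3 : ℕ) : ℝ)) * ((F.P Kt).L : ℝ)) :=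
      mul_le_mul hAL hAL (by norm_num) (by positivity)
    have hC : (1 : ℝ) ≤ (((4 * (F.P Kt).d + (3 * ((F.P Kt).d * (((F.P Kt).L - 1) / 2)) + 5) + 3 : ℕ) : ℝ)) ^ 2 * ((F.P Kt).L : ℝ) ^ 2 / 4 + ((3 * ((F.P Kt).d * (((F.P Kt).L - 1) / 2)) + 5 : ℕ) : ℝ) * (24 * (((((F.P Kt).d + 2) * (F.P Kt).L : ℕ) : ℝ) ^ 2 / 4)) := by
      nlinarith [h64, hB]
    have h1 := le_mul_of_one_le_left hεreg.le hC
    linarith [hfloor i, hm, h1]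
  -- (D1)′ with the three letters fed by their class producers at `δc = δW := δ i`
  exact exists_domain_prop1Printed_lfVarOn_std_su2_box_intrinsic_analytic_atZSeqCoPRecord_ofThm1TorusClass_ofMinimiserFamily_ofWindowGaugeLetter_ofChartHalfLetter_ofRightInverseLetter_explicit
    ν Kt hd3 h0 Z Λ k M hk0 hk1 eR heR T lo hi n hn hN hbox hZ hTG0 hN5 K hK1 hKn ext hext hlohi LO HI hLO hHI n' hn' hn'N hR' ρn hρn hγ hcJ hbx hbxM hM hR h𝓐₀
    hMin hΩw W hWbox C ρ Kτ ρτ hρ hKτ hρτ hhalf εH B M₂ hB0 hM₂0 hHB hsb hM₂ hγle hfar hZblk hM2 hdiv hcE0 hcE hB₃ heRa ha₀ hcA h15T hcJ'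
    δ hδpos hδle
    (hσW_on_uniform_of_class ν Kt h0 Z Λ k hk0 hk eR lo hi ext LO HI ρn hρn0 hdiv c hkc hc W hεreg hα3 hα2 haN X D₀ hXΩ hfit hBox hWX hfeedsX hfloor hfloor)
    (hPχ_on_of_class ν Kt Z Λ k hk0 eR ext LO HI ρn hεreg.le δ hδε) (hPbox_on_of_class ν Kt Z Λ k eR ext LO HI ρn hM2 hrad hdiv hεreg.le δ hδε)


end Summit.QuantumFields.YangMills.BalabanUVNodes.N12Prop1DirectOfClassWindowUniformExplicit

end
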